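import Mathlib
import HarnessLib
import Summits.HubbardSuperconductivity.HubbardSuperconductivity.Theorems.KLProgrammeKLRegimeTwoVolumeTowerStepCovSliceIncrL1
import Summits.HubbardSuperconductivity.HubbardSuperconductivity.Theorems.KLProgrammeKLRegimeTwoVolumeTowerStepCovEntryTwoFrame

/-!
# K3 VL child (stmt-HubbardSuperconductivity-20440), (G1) re-blocking support, part C: the TWO-FRAME increment of the plateau pull-back of a GENERIC slice
# `S(F̃_0[K′])ᵀ·C^{K′}_{(Λ,Λ′]}·S(F̃_0[K′]) − S(F̃_0[K])ᵀ·C^{K}_{(Λ,Λ′]}·S(F̃_0[K])` (`0 < Λ ≤ Λ′ ≤ Λ₁`) — entries (volume- and `M`-free) and plain rows / columns;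
# the d-free twin of p3 g19's `…StepCovZeroTwoFrame` (there the slice is `(Λ₂, Λ₁]` = `klStepCov … 0`)

Cell `gate-hubbard-kl`, seat p3 (g19); pen (R262) option (G1).  In the re-blocked VL tower block `0` integrates `(Λ_{d+1}, Λ₁]` through the scale-`0`
fat multiplier, which is the radial plateau there, so (§1) for ANY slice below `e₀` the pull-back through `F̃_0[K]` IS the pull-back through the constant
multiplier `𝟙` — at EVERY frame — and the two-frame increment is `S(𝟙)ᵀ·N(Ψ̂_{(Λ,Λ′]}[K′] − Ψ̂_{(Λ,Λ′]}[K])·S(𝟙)`; (§2) its ENTRIES are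
`≤ 2(Λ′/π+3)(1793Λ′+704)(16·(32/3)+16)/Λ²·P₀` from `|e_{K′} − e_K| ≤ P₀` (`β ≥ 1`; `sum_norm_sliceSymbolFreqIncr_le` + `shell_prefactor_le`); (§3) its PLAIN
rows / columns are `≤ Cr·(M/β)·(G₀/x)` in the two-scale class of part B (`incrSliceGen_wt_l1_le` read at weight `1`, g17's `rowSumWt_/colSumWt_pullback_one_le`).

* §1 `fatZero_pullback_sliceCT_eq_pullback_one`, `fatZero_pullback_sliceCT_sub_eq`;
* §2 **`norm_fatZero_sliceCT_sub_apply_le_unif`**;  §3 **`rowCol_fatZero_sliceCT_sub_le_of_jets`**.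

Everything is proved; no definitions, no sorry.  Nothing asserts any stub, K3, VL or superconductivity.
[cite: BenfattoGiulianiMastropietro2006, §2.5 (2.45), §2.7 (2.66)–(2.67), §2.8 (2.80), §3 (3.2)–(3.3)]
-/

noncomputable section

namespace Summit.HubbardSuperconductivity.HubbardSuperconductivity.Theorems.TorusFourierL2

set_option linter.dupNamespace false -- summit = problem name (single-conjunct summit), D-0017

open Set Finset Literature.MathematicalPhysics.QuantumLattice Literature.MathematicalPhysics.QuantumLattice.BandSectorCounting
open Literature.MathematicalPhysics.QuantumLattice.FermiRG Literature.Probability.LatticeModels Literature.Analysis.SpecialFunctions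
open Summit.HubbardSuperconductivity.HubbardSuperconductivity.Theorems.DispersionFlow
open Summit.HubbardSuperconductivity.HubbardSuperconductivity.Theorems.KLRegimeSplit
open Summit.HubbardSuperconductivity.HubbardSuperconductivity.Theorems.KLProgrammeLegKernels
open Summit.HubbardSuperconductivity.HubbardSuperconductivity.Theorems.PerturbedFermiCurve
open Summit.HubbardSuperconductivity.HubbardSuperconductivity.Theorems.KLRegimeWick
open Summit.HubbardSuperconductivity.HubbardSuperconductivity.Theorems.TwoVolumeSource
open scoped Real Nat

open Classical

/-! ## §1 Below `e₀` the scale-`0` fat pull-back of any slice is the constant-multiplier pull-back -/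

section Plateau

variable {V M : ℕ} [NeZero V] [NeZero M]

omit [NeZero M] in
/-- **For every slice `(Λ, Λ′]` with `0 < Λ ≤ Λ′ ≤ e₀` and every frame `K`**: `S(F̃_0[K])ᵀ·C^K_{(Λ,Λ′]}·S(F̃_0[K]) = S(𝟙)ᵀ·C^K_{(Λ,Λ′]}·S(𝟙)` (`β ≠ 0`; on the
slice's support both scale-`0` fat multipliers are `1`, off it the symbol vanishes). [cite: BenfattoGiulianiMastropietro2006, §2.5 (2.45), §2.7 (2.66)] -/
theorem fatZero_pullback_sliceCT_eq_pullback_one {β : ℝ} (hβ : β ≠ 0) (μ : ℝ) (K : TrigPolyC4v) {Λ Λ' : ℝ} (hΛ : 0 < Λ) (hΛΛ' : Λ ≤ Λ')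
    (hΛ'e : Λ' ≤ klE0) :
    (sectorSubMatrix V M β (bgmFatMultiplier V M klE0 β (nambuXiCT V μ K) 0)).transpose * hubbardCovSliceCT V M β μ 0 K Λ Λ' *
        sectorSubMatrix V M β (bgmFatMultiplier V M klE0 β (nambuXiCT V μ K) 0) =
      (sectorSubMatrix V M β (fun (_ : Fin (sectorCount 0)) (_ : FreqMomentum V M) => (1 : ℂ))).transpose * hubbardCovSliceCT V M β μ 0 K Λ Λ' *
        sectorSubMatrix V M β (fun (_ : Fin (sectorCount 0)) (_ : FreqMomentum V M) => (1 : ℂ)) := by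
  have he : (0 : ℝ) < klE0 := by norm_num [klE0]
  rw [hubbardCovSliceCT_eq_normalCovariance_sliceSymbolFnXi hβ μ K Λ Λ']
  refine pullback_normalCovariance_congr β _ _ _ _ fun ω ω' k σ => ?_
  obtain ⟨i, q⟩ := k
  rw [one_mul, one_mul]
  exact bgmFatMultiplier_zero_mul_sliceSymbolFnXi he β μ K hΛ hΛΛ' hΛ'e _ _ ω ω' i q

omit [NeZero M] in
/-- **The two-frame increment of the plateau pull-back of a slice is the constant-multiplier pull-back of the symbol increment**:
`S(F̃_0[K′])ᵀC^{K′}_{(Λ,Λ′]}S(F̃_0[K′]) − S(F̃_0[K])ᵀC^{K}_{(Λ,Λ′]}S(F̃_0[K]) = S(𝟙)ᵀ·N(Ψ̂_{(Λ,Λ′]}[K′] − Ψ̂_{(Λ,Λ′]}[K])·S(𝟙)`.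
[cite: BenfattoGiulianiMastropietro2006, §3 (3.3)] -/
theorem fatZero_pullback_sliceCT_sub_eq {β : ℝ} (hβ : β ≠ 0) (μ : ℝ) (K K' : TrigPolyC4v) {Λ Λ' : ℝ} (hΛ : 0 < Λ) (hΛΛ' : Λ ≤ Λ') (hΛ'e : Λ' ≤ klE0) :
    (sectorSubMatrix V M β (bgmFatMultiplier V M klE0 β (nambuXiCT V μ K') 0)).transpose * hubbardCovSliceCT V M β μ 0 K' Λ Λ' *
          sectorSubMatrix V M β (bgmFatMultiplier V M klE0 β (nambuXiCT V μ K') 0) -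
        (sectorSubMatrix V M β (bgmFatMultiplier V M klE0 β (nambuXiCT V μ K) 0)).transpose * hubbardCovSliceCT V M β μ 0 K Λ Λ' *
          sectorSubMatrix V M β (bgmFatMultiplier V M klE0 β (nambuXiCT V μ K) 0) =
      (sectorSubMatrix V M β (fun (_ : Fin (sectorCount 0)) (_ : FreqMomentum V M) => (1 : ℂ))).transpose *
          normalCovariance V M (fun ks =>
            sliceSymbolFnXi (β * (V : ℝ) ^ 2) 0 Λ Λ' (matsubaraFreq β M ks.1.1) (nambuXiCT V μ K' ks.1.2) -
              sliceSymbolFnXi (β * (V : ℝ) ^ 2) 0 Λ Λ' (matsubaraFreq β M ks.1.1) (nambuXiCT V μ K ks.1.2)) *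
        sectorSubMatrix V M β (fun (_ : Fin (sectorCount 0)) (_ : FreqMomentum V M) => (1 : ℂ)) := by
  rw [fatZero_pullback_sliceCT_eq_pullback_one hβ μ K' hΛ hΛΛ' hΛ'e, fatZero_pullback_sliceCT_eq_pullback_one hβ μ K hΛ hΛΛ' hΛ'e,
    ← hubbardCovSliceCT_sub_eq_normalCovariance hβ μ K K' Λ Λ', Matrix.mul_sub, Matrix.sub_mul]

end Plateau

/-! ## §2 Entries of the two-frame increment on a generic slice (volume- and `M`-free) -/

section Entry

variable {V M : ℕ} [NeZero V] [NeZero M]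

/-- **ENTRIES OF THE TWO-FRAME INCREMENT OF THE PLATEAU PULL-BACK OF A GENERIC SLICE** (two admissible frames, `0 < Λ ≤ Λ′ ≤ Λ₁`, `β ≥ 1`,
`|e_{K′} − e_K| ≤ P₀`): every entry is `≤ 2(Λ′/π+3)(1793Λ′+704)·((16·(32/3)+16)/Λ²)·P₀` — uniform in `V`, `M`, `β`.
[cite: BenfattoGiulianiMastropietro2006, §2.7 (2.66)–(2.67), §2.8 (2.80), §3 (3.2)–(3.3)] -/
theorem norm_fatZero_sliceCT_sub_apply_le_unif {R R' : RenConsts} {U U' : ℝ} {N N' : ℕ} {μ : ℝ} {K K' : TrigPolyC4v}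
    (hK : FrameOK R U N μ K) (hK' : FrameOK R' U' N' μ K') {β : ℝ} (hβ1 : 1 ≤ β) {Λ Λ' : ℝ} (hΛ : 0 < Λ) (hΛΛ' : Λ ≤ Λ')
    (hΛ'1 : Λ' ≤ klScale klE0 1) {P₀ : ℝ} (hP₀ : 0 ≤ P₀) (hv₀ : ∀ p, |frameLevel μ K' p - frameLevel μ K p| ≤ P₀)
    (X Y : SpaceTimeIdx V M × SectorLeg (sectorCount 0)) :
    ‖((sectorSubMatrix V M β (bgmFatMultiplier V M klE0 β (nambuXiCT V μ K') 0)).transpose * hubbardCovSliceCT V M β μ 0 K' Λ Λ' *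
          sectorSubMatrix V M β (bgmFatMultiplier V M klE0 β (nambuXiCT V μ K') 0) -
        (sectorSubMatrix V M β (bgmFatMultiplier V M klE0 β (nambuXiCT V μ K) 0)).transpose * hubbardCovSliceCT V M β μ 0 K Λ Λ' *
          sectorSubMatrix V M β (bgmFatMultiplier V M klE0 β (nambuXiCT V μ K) 0)) X Y‖ ≤
      2 * (Λ' / π + 3) * (1793 * Λ' + 704) * ((16 * (32 / 3) + 16) / Λ ^ 2) * P₀ := by
  have hβ : 0 < β := lt_of_lt_of_le one_pos hβ1
  have he : (0 : ℝ) < klE0 := by norm_num [klE0]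
  have hΛ1e : klScale klE0 1 ≤ klE0 := klScale_le_e0 he.le 1
  have hΛ'e : Λ' ≤ klE0 := hΛ'1.trans hΛ1e
  have hΛ't : Λ' < 3 / 80 := lt_of_le_of_lt hΛ'1 (klScale_klE0_lt_tube 1)
  rw [fatZero_pullback_sliceCT_sub_eq hβ.ne' μ K K' hΛ hΛΛ' hΛ'e]
  have h1 := norm_sectorSub_pullback_normalCovariance_le_of_sum (L := V) (M := M) β
    (fun (_ : Fin (sectorCount 0)) (_ : FreqMomentum V M) => (1 : ℂ)) (fun _ _ => by rw [norm_one])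
    (fun ks : FreqMomentum V M × Fin 2 =>
      sliceSymbolFnXi (β * (V : ℝ) ^ 2) 0 Λ Λ' (matsubaraFreq β M ks.1.1) (nambuXiCT V μ K' ks.1.2) -
        sliceSymbolFnXi (β * (V : ℝ) ^ 2) 0 Λ Λ' (matsubaraFreq β M ks.1.1) (nambuXiCT V μ K ks.1.2)) X Y
  refine h1.trans ?_
  have hc0 : ‖((1 / (β * (V : ℝ) ^ 2) : ℝ) : ℂ)‖ = 1 / (β * (V : ℝ) ^ 2) := by
    rw [Complex.norm_real, Real.norm_of_nonneg (by positivity)]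
  rw [hc0]
  have hfilter : ((Finset.univ : Finset (FreqMomentum V M)).filter fun _ => (1 : ℂ) ≠ 0) = Finset.univ :=
    filter_true_of_mem fun _ _ => one_ne_zero
  rw [hfilter]
  have hsum := sum_norm_sliceSymbolFreqIncr_le (V := V) (M := M) hK hK' hβ (c := β * (V : ℝ) ^ 2) (by positivity) hΛ hΛΛ' hΛ't hP₀ hv₀
  calc (1 / (β * (V : ℝ) ^ 2)) ^ 2 * ∑ k : FreqMomentum V M,
        ‖sliceSymbolFnXi (β * (V : ℝ) ^ 2) 0 Λ Λ' (matsubaraFreq β M (k, X.2.1.2).1.1) (nambuXiCT V μ K' (k, X.2.1.2).1.2) -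
          sliceSymbolFnXi (β * (V : ℝ) ^ 2) 0 Λ Λ' (matsubaraFreq β M (k, X.2.1.2).1.1) (nambuXiCT V μ K (k, X.2.1.2).1.2)‖
      ≤ (1 / (β * (V : ℝ) ^ 2)) ^ 2 * (2 * ((Λ' * β / π + 3) * (1793 * Λ' * (V : ℝ) ^ 2 + 704 * V)) * ((16 * (32 / 3) + 16) * (β * (V : ℝ) ^ 2) / Λ ^ 2 * P₀)) :=
        mul_le_mul_of_nonneg_left hsum (by positivity)
    _ = (1 / (β * (V : ℝ) ^ 2)) ^ 2 * ((Λ' * β / π + 3) * (1793 * Λ' * (V : ℝ) ^ 2 + 704 * V)) *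
          (β * (V : ℝ) ^ 2 * (2 * (16 * (32 / 3) + 16) / Λ ^ 2 * P₀)) := by ring
    _ ≤ (Λ' / π + 3) * (1793 * Λ' + 704) * (2 * (16 * (32 / 3) + 16) / Λ ^ 2 * P₀) :=
        shell_prefactor_le hβ1 (hΛ.le.trans hΛΛ') (by positivity)
    _ = _ := by ring

end Entry

/-! ## §3 Plain rows and columns of the two-frame increment on a generic slice -/

section RowsCols

/-- **PLAIN ROWS AND COLUMNS OF THE TWO-FRAME INCREMENT OF THE PLATEAU PULL-BACK OF A GENERIC SLICE** (`0 < Λ ≤ Λ′ ≤ Λ₁`): `∃ Cr > 0` (depending on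
`Λ, Λ′, K₃ˢ`) such that in the two-scale class `(G₀, x)` of part B (base frame `FrameOK` with `‖D³e_K‖ ≤ K₃ˢx`, the four increment jets, `klBetaMin ≤ β ≤ M`)
every row and every column is `≤ Cr·(M/β)·(G₀/x)`. [cite: BenfattoGiulianiMastropietro2006, §2.7 (2.66)–(2.67), §3 (3.2)–(3.3)] -/
theorem rowCol_fatZero_sliceCT_sub_le_of_jets {Λ Λ' : ℝ} (hΛ : 0 < Λ) (hΛΛ' : Λ ≤ Λ') (hΛ'1 : Λ' ≤ klScale klE0 1) (K₃s : ℝ) (hK₃s : 0 ≤ K₃s) :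
    ∃ Cr : ℝ, 0 < Cr ∧
      ∀ (V M : ℕ) [NeZero V] [NeZero M] (R : RenConsts) (U : ℝ) (N : ℕ) (R' : RenConsts) (U' : ℝ) (N' : ℕ) (μ : ℝ) (K K' : TrigPolyC4v),
      FrameOK R U N μ K → FrameOK R' U' N' μ K' →
      ∀ (G₀ x : ℝ), 0 ≤ G₀ → G₀ ≤ 1 → 1 ≤ x →
      (∀ p, ‖iteratedFDeriv ℝ 3 (frameLevel μ K) p‖ ≤ K₃s * x) →
      (∀ p, |frameLevel μ K' p - frameLevel μ K p| ≤ G₀ / x ^ 2) →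
      (∀ p, ‖fderiv ℝ (fun p => frameLevel μ K' p - frameLevel μ K p) p‖ ≤ G₀ / x) →
      (∀ p, ‖iteratedFDeriv ℝ 2 (fun p => frameLevel μ K' p - frameLevel μ K p) p‖ ≤ G₀) →
      (∀ p, ‖iteratedFDeriv ℝ 3 (fun p => frameLevel μ K' p - frameLevel μ K p) p‖ ≤ G₀ * x) →
      ∀ β : ℝ, klBetaMin ≤ β → β ≤ (M : ℝ) →
        (∀ X : SpaceTimeIdx V M × SectorLeg (sectorCount 0), ∑ Y : SpaceTimeIdx V M × SectorLeg (sectorCount 0),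
            ‖((sectorSubMatrix V M β (bgmFatMultiplier V M klE0 β (nambuXiCT V μ K') 0)).transpose * hubbardCovSliceCT V M β μ 0 K' Λ Λ' *
                  sectorSubMatrix V M β (bgmFatMultiplier V M klE0 β (nambuXiCT V μ K') 0) -
                (sectorSubMatrix V M β (bgmFatMultiplier V M klE0 β (nambuXiCT V μ K) 0)).transpose * hubbardCovSliceCT V M β μ 0 K Λ Λ' *
                  sectorSubMatrix V M β (bgmFatMultiplier V M klE0 β (nambuXiCT V μ K) 0)) X Y‖ ≤ Cr * ((M : ℝ) / β) * (G₀ / x)) ∧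
        (∀ Y : SpaceTimeIdx V M × SectorLeg (sectorCount 0), ∑ X : SpaceTimeIdx V M × SectorLeg (sectorCount 0),
            ‖((sectorSubMatrix V M β (bgmFatMultiplier V M klE0 β (nambuXiCT V μ K') 0)).transpose * hubbardCovSliceCT V M β μ 0 K' Λ Λ' *
                  sectorSubMatrix V M β (bgmFatMultiplier V M klE0 β (nambuXiCT V μ K') 0) -
                (sectorSubMatrix V M β (bgmFatMultiplier V M klE0 β (nambuXiCT V μ K) 0)).transpose * hubbardCovSliceCT V M β μ 0 K Λ Λ' *
                  sectorSubMatrix V M β (bgmFatMultiplier V M klE0 β (nambuXiCT V μ K) 0)) X Y‖ ≤ Cr * ((M : ℝ) / β) * (G₀ / x)) := by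
  obtain ⟨Cd, sd, hCd, hsd, hsd1, hincr⟩ := incrSliceGen_wt_l1_le hΛ hΛΛ' hΛ'1 K₃s hK₃s
  have he : (0 : ℝ) < klE0 := by norm_num [klE0]
  have hΛ'e : Λ' ≤ klE0 := hΛ'1.trans (klScale_le_e0 he.le 1)
  refine ⟨16 * Cd, by positivity, ?_⟩
  intro V M _ _ R U N R' U' N' μ K K' hK hK' G₀ x hG hG1 hx hK3 h0 h1 h2 h3 β hβmin hβM
  have hβ : 0 < β := pos_of_klBetaMin_le hβmin
  have hT := hincr V M R U N R' U' N' μ K K' hK hK' G₀ x hG hG1 hx hK3 h0 h1 h2 h3 β hβmin hβM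
  -- read the weighted bound at weight `1`
  have hT1 : ∑ z : TorusSite 1 (2 * M) × TorusSite 2 V, (fun _ : TorusSite 1 (2 * M) × TorusSite 2 V => (1 : ℝ)) z *
      ‖∑ q : TorusSite 1 (2 * M) × TorusSite 2 V, (torusChar q.1 z.1 * torusChar q.2 z.2) •
        ((((1 / (β * (V : ℝ) ^ 2) : ℝ) : ℂ) ^ 2 *
          (sliceSymbolFnXi (β * (V : ℝ) ^ 2) 0 Λ Λ' (matsubaraFreq β M ⟨(q.1 0).val, ZMod.val_lt (q.1 0)⟩) (nambuXiCT V μ K' q.2) -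
            sliceSymbolFnXi (β * (V : ℝ) ^ 2) 0 Λ Λ' (matsubaraFreq β M ⟨(q.1 0).val, ZMod.val_lt (q.1 0)⟩) (nambuXiCT V μ K q.2))))‖ ≤
      Cd * ((M : ℝ) / β) * (G₀ / x) := by
    refine le_trans (Finset.sum_le_sum fun z _ => mul_le_mul_of_nonneg_right ?_ (norm_nonneg _)) hT
    have ha : 0 ≤ sd / x * |(((z.2 0).valMinAbs : ℤ) : ℝ)| := by positivity
    have hb : 0 ≤ sd / x * |(((z.2 1).valMinAbs : ℤ) : ℝ)| := by positivity
    linarith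
  have hw0 : ∀ z : TorusSite 1 (2 * M) × TorusSite 2 V, 0 ≤ (fun _ : TorusSite 1 (2 * M) × TorusSite 2 V => (1 : ℝ)) z := fun _ => zero_le_one
  have hwev : ∀ (a : TorusSite 1 (2 * M)) (b : TorusSite 2 V), (fun _ : TorusSite 1 (2 * M) × TorusSite 2 V => (1 : ℝ)) (-a, -b) =
      (fun _ : TorusSite 1 (2 * M) × TorusSite 2 V => (1 : ℝ)) (a, b) := fun _ _ => rfl
  rw [fatZero_pullback_sliceCT_sub_eq hβ.ne' μ K K' hΛ hΛΛ' hΛ'e]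
  refine ⟨fun X => ?_, fun Y => ?_⟩
  · have h := rowSumWt_pullback_one_le hβ.ne' (fun ω k => sliceSymbolFnXi (β * (V : ℝ) ^ 2) 0 Λ Λ' ω (nambuXiCT V μ K' k) -
      sliceSymbolFnXi (β * (V : ℝ) ^ 2) 0 Λ Λ' ω (nambuXiCT V μ K k)) _ hw0 hwev hT1 X
    simp only [mul_one] at h
    calc _ ≤ 16 * (Cd * ((M : ℝ) / β) * (G₀ / x)) := h
      _ = 16 * Cd * ((M : ℝ) / β) * (G₀ / x) := by ring
  · have h := colSumWt_pullback_one_le hβ.ne' (fun ω k => sliceSymbolFnXi (β * (V : ℝ) ^ 2) 0 Λ Λ' ω (nambuXiCT V μ K' k) -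
      sliceSymbolFnXi (β * (V : ℝ) ^ 2) 0 Λ Λ' ω (nambuXiCT V μ K k)) _ hw0 hwev hT1 Y
    simp only [mul_one] at h
    calc _ ≤ 16 * (Cd * ((M : ℝ) / β) * (G₀ / x)) := h
      _ = 16 * Cd * ((M : ℝ) / β) * (G₀ / x) := by ring

end RowsCols

end Summit.HubbardSuperconductivity.HubbardSuperconductivity.Theorems.TorusFourierL2

end
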